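import Literature.Topology.FourManifolds.TautFoliationsLeafTopology
import HarnessLib

/-!
# The height of a flow box is constant along leafwise maps inside its source

Sibling of `TautFoliationsLeafTopology.lean` / `TautFoliationsPlaques.lean`. A continuous map
from a preconnected space into the leaf space `M^δ` whose image lies in the source of a flow
box `e` of the atlas has constant `e`-height `(e ·).2`: the plaques of `e` are open in the leaf topology,
so the height is locally constant along the map (Hector–Hirsch A, Ch. II 2.1.6: a path in a
leaf inside a distinguished open set stays in one plaque).

* `Foliation.height_eq_of_leafwise` (**proved**), with the path version
  `Foliation.height_eq_of_leafwise_path`.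

All statements are [folklore].
-/

noncomputable section

open Set Function
open scoped Topology unitInterval

namespace Literature.Topology.FourManifolds

namespace Foliation

variable {B : Type*} [TopologicalSpace B] {M : Type*} [TopologicalSpace M] (F : Foliation B M)
variable {e : OpenPartialHomeomorph M (B × ℝ)}

/-- **The height of a flow box is constant along a leafwise map of a preconnected space inside
its source.** [folklore] -/
theorem height_eq_of_leafwise {K : Type*} [TopologicalSpace K] [PreconnectedSpace K] (he : e ∈ F.atlas)
    {g : K → F.LeafSpace} (hg : Continuous g) (hsrc : ∀ k, ofLeafSpace (g k) ∈ e.source) (k k' : K) :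
    (e (ofLeafSpace (g k))).2 = (e (ofLeafSpace (g k'))).2 := by
  have key : IsLocallyConstant fun k ↦ (e (ofLeafSpace (g k))).2 := by
    refine (IsLocallyConstant.iff_eventually_eq _).2 fun k₀ ↦ ?_
    have hopen : IsOpen (g ⁻¹' (ofLeafSpace ⁻¹' plaque e (e (ofLeafSpace (g k₀))).2)) :=
      (F.isOpen_preimage_plaque_leafSpace he _).preimage hg
    have hmem : k₀ ∈ g ⁻¹' (ofLeafSpace ⁻¹' plaque e (e (ofLeafSpace (g k₀))).2) := ⟨hsrc k₀, rfl⟩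
    filter_upwards [hopen.mem_nhds hmem] with k hk
    exact hk.2
  exact key.apply_eq_of_preconnectedSpace k k'

/-- **Path version**: a leafwise path inside the source of a flow box has constant height.
[folklore] -/
theorem height_eq_of_leafwise_path (he : e ∈ F.atlas) {γ : I → M} (hγ : Continuous (toLeafSpace ∘ γ : I → F.LeafSpace))
    (hsrc : ∀ s, γ s ∈ e.source) (s s' : I) : (e (γ s)).2 = (e (γ s')).2 :=
  F.height_eq_of_leafwise he hγ hsrc s s'

end Foliation

end Literature.Topology.FourManifolds
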